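import Literature.IUT.HodgeTheaters.PiAvatarOuterHom
import HarnessLib

/-!
# [IUTchI] Ex 4.4 / Def 6.1 (i): the TRANSPORTER-OR-DEGENERATE ambient `ThetaAmb` (D-JΘ1-1 (iv-b′); generic group theory over
# abc-iut-L5-t4's orbit category and abc-iut-L5-t3's outer homomorphisms; no binder, no `Prop` fact)

S. Mochizuki, *Inter-universal Teichmüller theory I*, kurims manuscript (May 2020), §0 «Categories» p. 33 (morphisms of connected
anabelioids/temperoids = outer homomorphisms), Example 4.4 (i) pp. 106–107 («the poly-morphism … obtained by composing the natural
morphism `ℬ^temp(Π_v̲)⁰ → ℬ^temp(G_v̲)⁰` with the evaluation section `G_v̲ → Π_v̲` labeled `j`»), (ii) p. 107 («composing with arbitrary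
isomorphisms»), Definition 6.1 (i) p. 156. ([IUTchI] Ex 4.4 (i) p.106) [claim: Mochizuki2012, status: disputed] (D-0012 claim key, series
status DISPUTED — kernel definitions/theorems about abc-iut's OWN ambient design; nothing of the series is asserted; no side taken on
[IUTchIII] Cor. 3.12).

## What this file does (design D1 EMBEDDED, bad-place repair (iv-b′) of junction J-Θ-1)

abc-iut-w4-d054 `PiAvatarKitCoreObstruction` (p456090) shows that over the ORBIT CATEGORY `OrbitCat Π_{C_F}` (coset maps `xH ↦ xdH′`) every
endomorphism of `ℬ(Π_v̲)⁰` with `Π_v̲` closed is invertible, so Example 4.4's NON-injective `φ^Θ_{v̲_j} = [s_j ∘ aug]` is the class of no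
coset map and the frozen `EvalBinder`/`KitCore` are uninhabited at the D13 kits.  This file builds the ambient that hosts them: for an
augmentation `aug : A →* G` (at the kit: `augGF : Π_{C_F} → G_F`) and an object property `P` of `OrbitCat A` (at the kit: the objects in play),
`ThetaAmb aug P` has the objects of `P.FullSubcategory` and, as morphisms `X ⟶ Y`, triples `⟨deg, base, out⟩` of a tag, a TRANSPORT DATUM
`base : X ⟶ Y` of the orbit category (a coset map) and an OUTER HOMOMORPHISM `out : X → Y` over `Inn(G)` (abc-iut-L5-t3 `OuterHom`, `IsOver`),
with `out = toOuter base` on the étale summand (`deg = false`) and `out` DEGENERATE — over `Inn G` and killing `X ⊓ Ker aug`, the shape of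
`s_j ∘ aug` — on the other (`deg = true`).  Composition is componentwise (`deg` by `||`), so the category laws are those of `OrbitCat` and of
`OuterHom`; degenerate morphisms are absorbing and never invertible BY TAG, whence `Aut_Θ(X) = Aut_Orbit(X)` (`isoEquivFull`) with no
slimness / rigidity hypothesis; the projection `π` (transport datum) and the inclusion `ι` of the étale part are functors with `ι ⋙ π = 𝟭`.
PRICE IN FAITHFULNESS (recorded, RULINGS #86 / decision D-JΘ1-2): the transport datum `t` carried by a degenerate morphism is extra-print
bookkeeping of OUR embedded design, invisible to the comparison `σ : ThetaAmb ⥤ OuterCat` (`f ↦ f.out`); print's `φ^Θ_{v̲_j}` = the set of ALL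
`⟨true, t, φ⟩` with `φ ∈ thetaClass j` (abc-iut-L5-t3 `EvalSections.thetaClass`, `PiAvatarEvalSections` p456293).  STATUS OF RECORD: the coset
ambient hosts no §4 datum at closed `Π_v̲` (abc-iut-w4-d054 `PiAvatarKitCoreObstruction` p456090); the printed classes `[s_j ∘ aug]` exist as
NON-invertible outer homomorphisms outside the coset maps (`PiAvatarEvalSectionsNotCoset` p457456, over `PiAvatarOuterHom` p455871); this file is
the ambient in which both live side by side.  No side taken on [IUTchI] §4/§6 in print; a re-instantiation over OUR ambient witnesses the
consistency of OUR typing, not print's construction.  typed ≠ inhabited ≠ proved; binder ≠ fact.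
-/

namespace Literature.IUT.HodgeTheaters

open CategoryTheory

universe u v

variable {A : Type u} [Group A]

/-! ### §1. Degenerate outer homomorphisms over an augmentation -/

namespace OuterHom

variable {G : Type v} [Group G] (aug : A →* G) {H H' H'' : Subgroup A}

/-- A homomorphism `φ : H → H′` KILLS THE KERNEL PART if `φ(H ⊓ Ker aug) = 1` (the shape of `s ∘ aug|_H`).
([IUTchI] Ex 4.4 (i) p.106) [claim: Mochizuki2012, status: disputed] -/
def HomKillsKer (φ : H →* H') : Prop := ∀ x : H, aug (x : A) = 1 → φ x = 1

/-- Killing the kernel part is invariant under inner equivalence. ([IUTchI] Ex 4.4 (i) p.106) [claim: Mochizuki2012, status: disputed] -/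
theorem homKillsKer_of_innerEquiv {φ ψ : H →* H'} (h : InnerEquiv H H' φ ψ) (hφ : HomKillsKer aug φ) : HomKillsKer aug ψ := by
  obtain ⟨c, hc⟩ := h
  intro x hx
  rw [hc x, hφ x hx, mul_one, mul_inv_cancel]

/-- An outer homomorphism KILLS THE KERNEL PART if (any, equivalently every) representative does.
([IUTchI] Ex 4.4 (i) p.106) [claim: Mochizuki2012, status: disputed] -/
def KillsKer (f : OuterHom H H') : Prop :=
  Quotient.liftOn (s := innerSetoid H H') f (HomKillsKer aug) fun _ _ h =>
    propext ⟨homKillsKer_of_innerEquiv aug h, homKillsKer_of_innerEquiv aug (InnerEquiv.symm h)⟩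

/-- `KillsKer` on representatives. ([IUTchI] Ex 4.4 (i) p.106) [claim: Mochizuki2012, status: disputed] -/
theorem killsKer_ofHom_iff (φ : H →* H') : KillsKer aug (ofHom φ) ↔ HomKillsKer aug φ := Iff.rfl

/-- **DEGENERATE outer homomorphisms**: over `Inn(G)` AND killing the kernel part — the class of Example 4.4 (i)'s
`Π_v̲ ↠ G_v̲ → Π_v̲` and of all its composites with morphisms over `G`. ([IUTchI] Ex 4.4 (i) p.106) [claim: Mochizuki2012, status: disputed] -/
def IsDegOver (f : OuterHom H H') : Prop := f.IsOver aug ∧ f.KillsKer aug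

/-- The identity lies over `G`. ([IUTchI] §0 p.33) [claim: Mochizuki2012, status: disputed] -/
theorem isOver_id : (id H).IsOver aug := by
  rw [id, isOver_ofHom_iff]
  exact ⟨1, fun x => by simp⟩

/-- Composites of outer homomorphisms over `G` lie over `G`. ([IUTchI] §0 p.33) [claim: Mochizuki2012, status: disputed] -/
theorem IsOver.comp {f : OuterHom H H'} {g : OuterHom H' H''} (hf : f.IsOver aug) (hg : g.IsOver aug) : (f.comp g).IsOver aug := by
  obtain ⟨φ, rfl⟩ := ofHom_surjective f
  obtain ⟨ψ, rfl⟩ := ofHom_surjective g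
  rw [isOver_ofHom_iff] at hf hg
  obtain ⟨a, ha⟩ := hf
  obtain ⟨b, hb⟩ := hg
  rw [comp_ofHom, isOver_ofHom_iff]
  refine ⟨b * a, fun x => ?_⟩
  rw [MonoidHom.comp_apply, hb, ha]
  group

/-- A kernel-killing outer homomorphism followed by anything kills the kernel part. ([IUTchI] Ex 4.4 (i) p.106) [claim: Mochizuki2012, status: disputed] -/
theorem KillsKer.comp {f : OuterHom H H'} (hf : f.KillsKer aug) (g : OuterHom H' H'') : (f.comp g).KillsKer aug := by
  obtain ⟨φ, rfl⟩ := ofHom_surjective f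
  obtain ⟨ψ, rfl⟩ := ofHom_surjective g
  rw [killsKer_ofHom_iff] at hf
  rw [comp_ofHom, killsKer_ofHom_iff]
  intro x hx
  rw [MonoidHom.comp_apply, hf x hx, map_one]

/-- An outer homomorphism over `G` maps the kernel part into the kernel part, so following it by a kernel-killing one kills the kernel
part. ([IUTchI] Ex 4.4 (i) p.106) [claim: Mochizuki2012, status: disputed] -/
theorem IsOver.comp_killsKer {f : OuterHom H H'} (hf : f.IsOver aug) {g : OuterHom H' H''} (hg : g.KillsKer aug) :
    (f.comp g).KillsKer aug := by
  obtain ⟨φ, rfl⟩ := ofHom_surjective f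
  obtain ⟨ψ, rfl⟩ := ofHom_surjective g
  rw [isOver_ofHom_iff] at hf
  rw [killsKer_ofHom_iff] at hg
  obtain ⟨a, ha⟩ := hf
  rw [comp_ofHom, killsKer_ofHom_iff]
  intro x hx
  rw [MonoidHom.comp_apply]
  refine hg _ ?_
  rw [ha x, hx, mul_one, mul_inv_cancel]

/-- Degenerate ∘ (over `G`) is degenerate. ([IUTchI] Ex 4.4 (ii) p.107) [claim: Mochizuki2012, status: disputed] -/
theorem IsDegOver.comp_isOver {f : OuterHom H H'} {g : OuterHom H' H''} (hf : f.IsDegOver aug) (hg : g.IsOver aug) :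
    (f.comp g).IsDegOver aug :=
  ⟨hf.1.comp aug hg, hf.2.comp aug g⟩

/-- (Over `G`) ∘ degenerate is degenerate. ([IUTchI] Ex 4.4 (ii) p.107) [claim: Mochizuki2012, status: disputed] -/
theorem IsOver.comp_isDegOver {f : OuterHom H H'} {g : OuterHom H' H''} (hf : f.IsOver aug) (hg : g.IsDegOver aug) :
    (f.comp g).IsDegOver aug :=
  ⟨hf.comp aug hg.1, hf.comp_killsKer aug hg.2⟩

/-- A degenerate outer ENDOmorphism of `H` is not the identity as soon as `H` meets `Ker aug` nontrivially.
([IUTchI] Ex 4.4 (i) p.106) [claim: Mochizuki2012, status: disputed] -/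
theorem IsDegOver.ne_id {f : OuterHom H H} (hf : f.IsDegOver aug) (hΔ : ∃ x : H, aug (x : A) = 1 ∧ x ≠ 1) : f ≠ id H := by
  rintro rfl
  obtain ⟨x, hx, hx1⟩ := hΔ
  have h := hf.2
  rw [id, killsKer_ofHom_iff] at h
  exact hx1 (h x hx)

end OuterHom

/-! ### §2. The orbit category: `toOuter` lies over `G` -/

namespace OrbitCat

variable {G : Type v} [Group G] (aug : A →* G)

/-- The outer homomorphism of a coset map lies over `G`. ([IUTchI] §0 p.33) [claim: Mochizuki2012, status: disputed] -/
theorem isOver_toOuter {H H' : Subgroup A} (f : (of H : OrbitCat A) ⟶ of H') : (toOuter f).IsOver aug := by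
  obtain ⟨d, hd, rfl⟩ := exists_eq_homOfElem f
  rw [toOuter_homOfElem]
  exact OuterHom.isOver_ofConj aug d hd

end OrbitCat

/-! ### §3. `ThetaAmb`: objects, tagged morphisms, the category structure -/

/-- **The transporter-or-degenerate ambient** on the objects of `P.FullSubcategory ⊆ OrbitCat A`.
([IUTchI] Def 6.1 (i) p.156) [claim: Mochizuki2012, status: disputed] -/
structure ThetaAmb {G : Type v} [Group G] (aug : A →* G) (P : ObjectProperty (OrbitCat A)) : Type u where
  /-- the underlying object of the orbit category (an object in play) -/
  toFull : P.FullSubcategory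

namespace ThetaAmb

variable {G : Type v} [Group G] {aug : A →* G} {P : ObjectProperty (OrbitCat A)}

/-- The underlying subgroup. ([IUTchI] Def 6.1 (i) p.156) [claim: Mochizuki2012, status: disputed] -/
abbrev sub (X : ThetaAmb aug P) : Subgroup A := OrbitCat.sub X.toFull.obj

/-- **Morphisms of `ThetaAmb`**: a tag, a transport datum (coset map) and an outer homomorphism over `Inn G`, étale (`out = toOuter base`)
or degenerate according to the tag. ([IUTchI] Ex 4.4 (i) p.106) [claim: Mochizuki2012, status: disputed] -/
@[ext]
structure Hom (X Y : ThetaAmb aug P) : Type u where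
  /-- `false`: étale (a coset map); `true`: degenerate -/
  deg : Bool
  /-- the transport datum: a morphism of the orbit category between the underlying objects -/
  base : X.toFull ⟶ Y.toFull
  /-- the outer homomorphism `X → Y` -/
  out : OuterHom X.sub Y.sub
  /-- … over `Inn G` -/
  out_isOver : out.IsOver aug
  /-- étale morphisms: the outer homomorphism IS that of the transport datum -/
  etale_spec : deg = false → out = OrbitCat.toOuter base.hom
  /-- degenerate morphisms: the outer homomorphism kills the kernel part -/
  deg_spec : deg = true → out.IsDegOver aug

/-- Identity: étale, identity transport, identity outer homomorphism. ([IUTchI] §0 p.33) [claim: Mochizuki2012, status: disputed] -/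
noncomputable def Hom.id (X : ThetaAmb aug P) : Hom X X where
  deg := false
  base := 𝟙 _
  out := OuterHom.id X.sub
  out_isOver := OuterHom.isOver_id aug
  etale_spec _ := (OrbitCat.toOuter_id X.sub).symm
  deg_spec h := absurd h (by decide)

/-- Composition: componentwise; the tag by `||` (degenerate morphisms are absorbing). ([IUTchI] Ex 4.4 (ii) p.107) [claim: Mochizuki2012, status: disputed] -/
noncomputable def Hom.comp {X Y Z : ThetaAmb aug P} (f : Hom X Y) (g : Hom Y Z) : Hom X Z where
  deg := f.deg || g.deg
  base := f.base ≫ g.base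
  out := f.out.comp g.out
  out_isOver := f.out_isOver.comp aug g.out_isOver
  etale_spec h := by
    rw [Bool.or_eq_false_iff] at h
    rw [f.etale_spec h.1, g.etale_spec h.2]
    exact (OrbitCat.toOuter_comp f.base.hom g.base.hom).symm
  deg_spec h := by
    cases hf : f.deg
    · have hg : g.deg = true := by rw [hf, Bool.false_or] at h; exact h
      exact f.out_isOver.comp_isDegOver aug (g.deg_spec hg)
    · exact (f.deg_spec hf).comp_isOver aug g.out_isOver

/-- **The category structure of `ThetaAmb`** (laws: `Bool.or` + `OrbitCat` + `OuterHom.id_comp/comp_id/comp_assoc`).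
([IUTchI] §0 p.33) [claim: Mochizuki2012, status: disputed] -/
@[reducible]
noncomputable def category : Category.{u} (ThetaAmb aug P) where
  Hom := Hom
  id := Hom.id
  comp := Hom.comp
  id_comp f := Hom.ext (by simp [Hom.id, Hom.comp]) (by simp [Hom.id, Hom.comp]) (by
    change (OuterHom.id _).comp f.out = f.out
    exact OuterHom.id_comp f.out)
  comp_id f := Hom.ext (by simp [Hom.id, Hom.comp]) (by simp [Hom.id, Hom.comp]) (by
    change f.out.comp (OuterHom.id _) = f.out
    exact OuterHom.comp_id f.out)
  assoc f g h := Hom.ext (by simp [Hom.comp, Bool.or_assoc]) (by simp [Hom.comp]) (by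
    change (f.out.comp g.out).comp h.out = f.out.comp (g.out.comp h.out)
    exact OuterHom.comp_assoc _ _ _)

attribute [instance] ThetaAmb.category

section Laws

variable {X Y Z : ThetaAmb aug P}

/-- The identity is étale. ([IUTchI] §0 p.33) [claim: Mochizuki2012, status: disputed] -/
@[simp] theorem deg_id : (𝟙 X : X ⟶ X).deg = false := rfl
/-- The identity has identity transport datum. ([IUTchI] §0 p.33) [claim: Mochizuki2012, status: disputed] -/
@[simp] theorem base_id : (𝟙 X : X ⟶ X).base = 𝟙 X.toFull := rfl
/-- The identity has identity outer homomorphism. ([IUTchI] §0 p.33) [claim: Mochizuki2012, status: disputed] -/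
@[simp] theorem out_id : (𝟙 X : X ⟶ X).out = OuterHom.id X.sub := rfl
/-- Tags compose by `||`. ([IUTchI] Ex 4.4 (ii) p.107) [claim: Mochizuki2012, status: disputed] -/
@[simp] theorem deg_comp (f : X ⟶ Y) (g : Y ⟶ Z) : (f ≫ g).deg = (f.deg || g.deg) := rfl
/-- Transport data compose in the orbit category. ([IUTchI] §0 p.33) [claim: Mochizuki2012, status: disputed] -/
@[simp] theorem base_comp (f : X ⟶ Y) (g : Y ⟶ Z) : (f ≫ g).base = f.base ≫ g.base := rfl
/-- Outer homomorphisms compose. ([IUTchI] §0 p.33) [claim: Mochizuki2012, status: disputed] -/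
@[simp] theorem out_comp (f : X ⟶ Y) (g : Y ⟶ Z) : (f ≫ g).out = f.out.comp g.out := rfl

end Laws

/-! ### §4. The étale inclusion `ι`, the transport projection `π`; isomorphisms are étale -/

variable (aug P)

/-- **`ι`: the objects in play with their coset maps, as the étale part of `ThetaAmb`.** ([IUTchI] Def 6.1 (i) p.156) [claim: Mochizuki2012, status: disputed] -/
noncomputable def ι : P.FullSubcategory ⥤ ThetaAmb aug P where
  obj X := ⟨X⟩
  map f := ⟨false, f, OrbitCat.toOuter f.hom, OrbitCat.isOver_toOuter aug f.hom, fun _ => rfl, fun h => absurd h (by decide)⟩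
  map_id X := Hom.ext rfl rfl (OrbitCat.toOuter_id _)
  map_comp f g := Hom.ext rfl rfl (OrbitCat.toOuter_comp f.hom g.hom)

/-- **`π`: the transport datum** — forgets the tag and the outer homomorphism. ([IUTchI] Def 6.1 (i) p.156) [claim: Mochizuki2012, status: disputed] -/
def π : ThetaAmb aug P ⥤ P.FullSubcategory where
  obj X := X.toFull
  map f := f.base

variable {aug P}

/-- `ι ⋙ π = 𝟭`. ([IUTchI] Def 6.1 (i) p.156) [claim: Mochizuki2012, status: disputed] -/
theorem ι_comp_π : ι aug P ⋙ π aug P = 𝟭 _ := rfl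

/-- `π (ι X) = X`. ([IUTchI] Def 6.1 (i) p.156) [claim: Mochizuki2012, status: disputed] -/
@[simp] theorem π_obj_ι_obj (X : P.FullSubcategory) : (π aug P).obj ((ι aug P).obj X) = X := rfl
/-- `π (ι f) = f`. ([IUTchI] Def 6.1 (i) p.156) [claim: Mochizuki2012, status: disputed] -/
@[simp] theorem π_map_ι_map {X Y : P.FullSubcategory} (f : X ⟶ Y) : (π aug P).map ((ι aug P).map f) = f := rfl
/-- The underlying object of `ι X` is `X`. ([IUTchI] Def 6.1 (i) p.156) [claim: Mochizuki2012, status: disputed] -/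
@[simp] theorem ι_obj_toFull (X : P.FullSubcategory) : ((ι aug P).obj X).toFull = X := rfl
/-- `ι f` is étale. ([IUTchI] Def 6.1 (i) p.156) [claim: Mochizuki2012, status: disputed] -/
@[simp] theorem deg_ι_map {X Y : P.FullSubcategory} (f : X ⟶ Y) : ((ι aug P).map f).deg = false := rfl
/-- The outer homomorphism of `ι f` is `toOuter f`. ([IUTchI] §0 p.33) [claim: Mochizuki2012, status: disputed] -/
@[simp] theorem out_ι_map {X Y : P.FullSubcategory} (f : X ⟶ Y) : ((ι aug P).map f).out = OrbitCat.toOuter f.hom := rfl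

/-- `ι` hits every object. ([IUTchI] Def 6.1 (i) p.156) [claim: Mochizuki2012, status: disputed] -/
theorem ι_obj_π_obj (X : ThetaAmb aug P) : (ι aug P).obj ((π aug P).obj X) = X := by
  cases X; rfl

/-- An étale morphism is `ι` of its transport datum. ([IUTchI] Def 6.1 (i) p.156) [claim: Mochizuki2012, status: disputed] -/
theorem eq_ι_map_of_deg_eq_false {X Y : P.FullSubcategory} (f : (ι aug P).obj X ⟶ (ι aug P).obj Y) (hf : f.deg = false) :
    f = (ι aug P).map f.base :=
  Hom.ext hf rfl (f.etale_spec hf)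

/-- **Isomorphisms are étale** (a degenerate morphism is absorbing, the identity is étale).
([IUTchI] Def 6.1 (i) p.156) [claim: Mochizuki2012, status: disputed] -/
theorem deg_hom_eq_false {X Y : ThetaAmb aug P} (e : X ≅ Y) : e.hom.deg = false := by
  have h := congrArg Hom.deg e.hom_inv_id
  rw [deg_comp, deg_id, Bool.or_eq_false_iff] at h
  exact h.1

/-- The inverse of an isomorphism is étale. ([IUTchI] Def 6.1 (i) p.156) [claim: Mochizuki2012, status: disputed] -/
theorem deg_inv_eq_false {X Y : ThetaAmb aug P} (e : X ≅ Y) : e.inv.deg = false :=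
  deg_hom_eq_false e.symm

/-- **`Iso_Θ(X, Y) ≃ Iso_Orbit(X, Y)`**: the isomorphisms of `ThetaAmb` are exactly the coset isomorphisms of the objects in play — no slimness,
no rigidity binder. ([IUTchI] Def 6.1 (i) p.156) [claim: Mochizuki2012, status: disputed] -/
noncomputable def isoEquivFull (X Y : P.FullSubcategory) : ((ι aug P).obj X ≅ (ι aug P).obj Y) ≃ (X ≅ Y) where
  toFun e := (π aug P).mapIso e
  invFun e := (ι aug P).mapIso e
  left_inv e := Iso.ext (by
    change (ι aug P).map e.hom.base = e.hom
    exact (eq_ι_map_of_deg_eq_false e.hom (deg_hom_eq_false e)).symm)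
  right_inv e := Iso.ext rfl

/-- `isoEquivFull` is `π.mapIso`. ([IUTchI] Def 6.1 (i) p.156) [claim: Mochizuki2012, status: disputed] -/
@[simp] theorem isoEquivFull_apply {X Y : P.FullSubcategory} (e : (ι aug P).obj X ≅ (ι aug P).obj Y) :
    isoEquivFull X Y e = (π aug P).mapIso e := rfl
/-- `isoEquivFull.symm` is `ι.mapIso`. ([IUTchI] Def 6.1 (i) p.156) [claim: Mochizuki2012, status: disputed] -/
@[simp] theorem isoEquivFull_symm_apply {X Y : P.FullSubcategory} (e : X ≅ Y) :
    (isoEquivFull (aug := aug) X Y).symm e = (ι aug P).mapIso e := rfl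

/-- `isoEquivFull` respects composition. ([IUTchI] Def 6.1 (i) p.156) [claim: Mochizuki2012, status: disputed] -/
theorem isoEquivFull_trans {X Y Z : P.FullSubcategory} (e : (ι aug P).obj X ≅ (ι aug P).obj Y) (e' : (ι aug P).obj Y ≅ (ι aug P).obj Z) :
    isoEquivFull X Z (e ≪≫ e') = isoEquivFull X Y e ≪≫ isoEquivFull Y Z e' :=
  Functor.mapIso_trans _ _ _

/-- `isoEquivFull` respects the identity. ([IUTchI] Def 6.1 (i) p.156) [claim: Mochizuki2012, status: disputed] -/
theorem isoEquivFull_refl (X : P.FullSubcategory) : isoEquivFull X X (Iso.refl ((ι aug P).obj X)) = Iso.refl X :=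
  Functor.mapIso_refl _ _

/-- Isomorphs in `ThetaAmb` are isomorphs in the orbit category and conversely. ([IUTchI] Def 4.1 (i) p.95) [claim: Mochizuki2012, status: disputed] -/
theorem nonempty_iso_iff (X Y : P.FullSubcategory) : Nonempty ((ι aug P).obj X ≅ (ι aug P).obj Y) ↔ Nonempty (X ≅ Y) :=
  ⟨fun ⟨e⟩ => ⟨isoEquivFull X Y e⟩, fun ⟨e⟩ => ⟨(isoEquivFull X Y).symm e⟩⟩

/-- **`Aut_Θ(X) ≃* Aut_Orbit(X)`** — hence `≃* N_A(X)/X` by abc-iut-L5-t4's `OrbitCat.autEquiv` (p424570): every landed label law of the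
automorphism groups transfers verbatim. ([IUTchI] Def 6.1 (iii) p.157) [claim: Mochizuki2012, status: disputed] -/
noncomputable def autEquivFull (X : P.FullSubcategory) : Aut ((ι aug P).obj X) ≃* Aut X where
  toEquiv := isoEquivFull X X
  map_mul' e e' := by
    change (π aug P).mapIso (e' ≪≫ e) = (π aug P).mapIso e' ≪≫ (π aug P).mapIso e
    exact Functor.mapIso_trans _ _ _

/-! ### §5. Degenerate endomorphisms: the necessary condition (O1) of abc-iut-w4-d054 p456090 is met by tag -/

/-- A degenerate morphism is not an isomorphism. ([IUTchI] Ex 4.4 (i) p.106) [claim: Mochizuki2012, status: disputed] -/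
theorem not_isIso_of_deg {X Y : ThetaAmb aug P} (f : X ⟶ Y) (hf : f.deg = true) : ¬ IsIso f := by
  intro h
  have := deg_hom_eq_false (asIso f)
  rw [asIso_hom, hf] at this
  exact Bool.noConfusion this

/-- **The degenerate morphism with prescribed transport datum and outer homomorphism.** ([IUTchI] Ex 4.4 (i) p.106) [claim: Mochizuki2012, status: disputed] -/
def degHom {X Y : P.FullSubcategory} (t : X ⟶ Y) (φ : OuterHom (OrbitCat.sub X.obj) (OrbitCat.sub Y.obj)) (hφ : φ.IsDegOver aug) :
    (ι aug P).obj X ⟶ (ι aug P).obj Y :=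
  ⟨true, t, φ, hφ.1, fun h => absurd h (by decide), fun _ => hφ⟩

/-- `degHom` is degenerate. ([IUTchI] Ex 4.4 (i) p.106) [claim: Mochizuki2012, status: disputed] -/
@[simp] theorem deg_degHom {X Y : P.FullSubcategory} (t : X ⟶ Y) (φ) (hφ : φ.IsDegOver aug) : (degHom t φ hφ).deg = true := rfl
/-- The transport datum of `degHom t φ`. ([IUTchI] Ex 4.4 (i) p.106) [claim: Mochizuki2012, status: disputed] -/
@[simp] theorem base_degHom {X Y : P.FullSubcategory} (t : X ⟶ Y) (φ) (hφ : φ.IsDegOver aug) : (degHom t φ hφ).base = t := rfl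
/-- The outer homomorphism of `degHom t φ`. ([IUTchI] Ex 4.4 (i) p.106) [claim: Mochizuki2012, status: disputed] -/
@[simp] theorem out_degHom {X Y : P.FullSubcategory} (t : X ⟶ Y) (φ) (hφ : φ.IsDegOver aug) : (degHom t φ hφ).out = φ := rfl

/-- **(O1) met**: every object whose orbit-category endomorphisms and degenerate outer endomorphisms are both available has a NON-invertible
endomorphism in `ThetaAmb`. ([IUTchI] Ex 4.4 (i) p.106) [claim: Mochizuki2012, status: disputed] -/
theorem exists_endo_not_isIso (X : P.FullSubcategory) (φ : OuterHom (OrbitCat.sub X.obj) (OrbitCat.sub X.obj)) (hφ : φ.IsDegOver aug) :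
    ∃ f : (ι aug P).obj X ⟶ (ι aug P).obj X, ¬ IsIso f :=
  ⟨degHom (𝟙 X) φ hφ, not_isIso_of_deg _ rfl⟩

/-- Two-sided composites of a degenerate morphism with isomorphisms: tag, transport datum and outer homomorphism.
([IUTchI] Ex 4.4 (ii) p.107) [claim: Mochizuki2012, status: disputed] -/
theorem out_iso_comp_comp_iso {X Y : ThetaAmb aug P} (θ : X ≅ X) (f : X ⟶ Y) (β : Y ≅ Y) :
    (θ.hom ≫ f ≫ β.hom).out = ((OrbitCat.toOuter θ.hom.base.hom).comp f.out).comp (OrbitCat.toOuter β.hom.base.hom) := by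
  rw [out_comp, out_comp, θ.hom.etale_spec (deg_hom_eq_false θ), β.hom.etale_spec (deg_hom_eq_false β)]
  exact (OuterHom.comp_assoc _ _ _).symm

end ThetaAmb

end Literature.IUT.HodgeTheaters
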